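import Literature.AnabelianGeometry.EtaleTheta.SettingModelChiTwist
import HarnessLib

/-!
# A model of the [EtTh] §1 root, χ-twisted reshape (R78 (B)), part F2b: JOINT continuity of the twist
# `(σ, x) ↦ θ_{c(σ)} x` from level-wise local constancy of the character (proof-only)

Mochizuki, *The étale theta function …*, Publ. RIMS **45** (2009) [EtTh], §1, PRIMS PDF p. 12
[cite: MochizukiEtTh2009, §1 p.12] ("`Δ_X` … a profinite free group on 2 generators"; the cyclotomic action on
"`Δ_Θ (≅ Ẑ(1))`"). Layer L2 of the abc-iut cell, seat abc-iut-w5-d024 (gen 3), R78 cluster (abc-iut-L2-lead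
RULINGS #13 R100, integration owner abc-iut-L6-d6): the input of F4 (`SettingModelChiSemidirect`, abc-iut-w5-d249)
"`IsTopologicalGroup` on `Γ ⋊_χ G_{ℚ_p}` via JOINT continuity proved level-wise". PROOF-ONLY sequel of
`SettingModelChiTwist.lean` (F2): no definition, nothing of another seat restated.

WHAT IS PROVED. For a topological space `G` and ANY map `c : G → Aut(Ẑ)` such that every level character
`σ ↦ χ_N(c σ) = ZHatLevel.levelChar N (c σ)` is locally constant (F3 proves this for the cyclotomic character of
`G_{ℚ_p}` with its Krull topology):
* `apply_bPow_eq_pow` — for a continuous homomorphism `π : F̂₂ → Q` to a finite discrete group of exponent dividing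
  `e`, `π (b^t) = π(η b)^{(t mod e)}`: the value of `π` on `b^Ẑ` only depends on the level-`e` class of the exponent;
* `val_twist_eq` — the `H`-component (`H` a finite-index normal subgroup of `F₂`) of `θ_φ x` is
  `ḡ (x mod K)` for any homomorphism `f : F₂ → F₂/H` with `a ↦ a, b ↦ b^{c₀}`, `c₀ = χ_e(φ)` (`e` the exponent
  of `F₂/H`) and any finite-index normal `K ≤ Ker f` (`ḡ` the induced map): it depends on `φ` only through
  `χ_e(φ)` and on `x` only through a finite quotient;
* **`continuous_twist_of_isLocallyConstant`**: `Continuous fun q : G × F̂₂ => twist (c q.1) q.2`;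
* **`continuous_twistGfp_of_isLocallyConstant`**: the same on `Γ = F̂₂ ×_Ẑ ℤ` for `twistGfp`.
SEMI-SYNTHETIC MODEL, CONSISTENCY EVIDENCE ONLY; nothing of [EtTh] is asserted; no side is taken on [IUTchIII]
Cor. 3.12.
-/

noncomputable section

namespace Literature.AnabelianGeometry.EtaleTheta.SettingModel

open Literature.AnabelianGeometry.SemiGraphs
open Literature.AnabelianGeometry.AbsoluteAnabelian
open CategoryTheory Function ProfiniteGrp ProfiniteGrp.ProfiniteCompletion

/-- **`π (b^t) = π(η b)^{t mod e}`** for a continuous homomorphism `π : F̂₂ → Q` into a discrete group killed by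
`e`-th powers: write `t = z^e · η k` (`ZHatLevel.level_eq_one_iff_exists_pow`). [cite: MochizukiEtTh2009, §1 p.12] -/
theorem apply_bPow_eq_pow {Q : Type*} [Group Q] [TopologicalSpace Q] (π : F₂hatT →ₜ* Q) (e : ℕ+)
    (he : ∀ q : Q, q ^ (e : ℕ) = 1) (t : ZH) :
    π (bPow t) = π (eta (FreeGroup.of 1)) ^ (Multiplicative.toAdd (ZHatLevel.level e t)).val := by
  haveI : NeZero (e : ℕ) := ⟨e.ne_zero⟩
  set k : ℕ := (Multiplicative.toAdd (ZHatLevel.level e t)).val with hkdef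
  have hk : ZHatLevel.level e t = ZHatLevel.level e (ZHatLevel.eta (k : ℤ)) := by
    rw [ZHatLevel.level_eta, Int.cast_natCast, hkdef, ZMod.natCast_zmod_val, ofAdd_toAdd]
  have h1 : ZHatLevel.level e (t * (ZHatLevel.eta (k : ℤ))⁻¹) = 1 := by
    rw [map_mul, map_inv, hk, mul_inv_cancel]
  obtain ⟨z, hz⟩ := (ZHatLevel.level_eq_one_iff_exists_pow e _).mp h1
  have ht : t = z ^ (e : ℕ) * ZHatLevel.eta (k : ℤ) := by rw [hz, inv_mul_cancel_right]
  have hb : bPow (ZHatLevel.eta (k : ℤ)) = eta (FreeGroup.of 1) ^ k := by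
    change bPow (iotaZ (Multiplicative.ofAdd (k : ℤ))) = _
    rw [bPow_iotaZ, toAdd_ofAdd, zpow_natCast]
  rw [ht, map_mul, map_mul, map_pow, map_pow, he, one_mul, hb, map_pow]

/-! ### The finite quotients `F₂ → F₂/H` twisted by `c₀`: `a ↦ a`, `b ↦ b^{c₀}` -/

/-- The exponent of the finite quotient `F₂/H`, as a positive integer. [cite: MochizukiEtTh2009, §1 p.12] -/
theorem exponent_quotient_pos (H : FiniteIndexNormalSubgroup F₂) :
    0 < Monoid.exponent (F₂ ⧸ H.toSubgroup) :=
  Monoid.exponent_pos.mpr Monoid.ExponentExists.of_finite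

/-- **Component formula for the twist.** Let `H ≤ F₂` be normal of finite index, `e` the exponent of `F₂/H`,
`φ ∈ Aut(Ẑ)` and `c₀ := χ_e(φ)`. For any homomorphism `f : F₂ → F₂/H` with `a ↦ ā`, `b ↦ b̄^{c₀.val}` and any
finite-index normal `K ≤ Ker f`, the `H`-component of `θ_φ x` is the image under `F₂/K → F₂/H` of the `K`-component
of `x` — so it depends on `φ` only through `χ_e(φ)` and on `x` only through `x mod K`. [cite: MochizukiEtTh2009, §1 p.12] -/
theorem val_twist_eq (H : FiniteIndexNormalSubgroup F₂) (φ : MulAut ZH) (x : F₂hatT)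
    (c₀ : ZMod (⟨Monoid.exponent (F₂ ⧸ H.toSubgroup), exponent_quotient_pos H⟩ : ℕ+))
    (hc₀ : ZHatLevel.levelChar ⟨Monoid.exponent (F₂ ⧸ H.toSubgroup), exponent_quotient_pos H⟩ φ = c₀)
    (f : F₂ →* F₂ ⧸ H.toSubgroup) (hfa : f (FreeGroup.of 0) = QuotientGroup.mk (FreeGroup.of 0))
    (hfb : f (FreeGroup.of 1) = QuotientGroup.mk (FreeGroup.of 1) ^ c₀.val)
    (K : FiniteIndexNormalSubgroup F₂) (hK : K.toSubgroup ≤ f.ker) :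
    (twist φ x).val H = QuotientGroup.lift K.toSubgroup f hK (x.val K) := by
  letI : TopologicalSpace (F₂ ⧸ H.toSubgroup) := ⊥
  haveI : DiscreteTopology (F₂ ⧸ H.toSubgroup) := ⟨rfl⟩
  haveI : DiscreteTopology ((diagram (GrpCat.of F₂)).obj H) := ⟨rfl⟩
  haveI : DiscreteTopology ((diagram (GrpCat.of F₂)).obj K) := ⟨rfl⟩
  -- the `H`-component and (the push-forward of) the `K`-component as continuous homomorphisms out of `F̂₂`
  let πH : F₂hatT →ₜ* (F₂ ⧸ H.toSubgroup) :=
    { toFun := fun y => y.val H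
      map_one' := rfl
      map_mul' := fun _ _ => rfl
      continuous_toFun := (continuous_apply H).comp continuous_subtype_val }
  let ρ : F₂hatT →ₜ* (F₂ ⧸ H.toSubgroup) :=
    { toFun := fun y => QuotientGroup.lift K.toSubgroup f hK (y.val K)
      map_one' := by
        change QuotientGroup.lift K.toSubgroup f hK 1 = 1
        exact map_one _
      map_mul' := fun y y' => map_mul (QuotientGroup.lift K.toSubgroup f hK) (y.val K) (y'.val K)
      continuous_toFun := by
        letI : TopologicalSpace (F₂ ⧸ K.toSubgroup) := ⊥
        haveI : DiscreteTopology (F₂ ⧸ K.toSubgroup) := ⟨rfl⟩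
        have hcK : Continuous fun y : F₂hatT => (y.val K : F₂ ⧸ K.toSubgroup) :=
          (continuous_apply K).comp continuous_subtype_val
        exact Continuous.comp (g := fun w : F₂ ⧸ K.toSubgroup => QuotientGroup.lift K.toSubgroup f hK w)
          continuous_of_discreteTopology hcK }
  have hπη : ∀ g : F₂, πH (eta g) = QuotientGroup.mk g := fun _ => rfl
  have hρη : ∀ g : F₂, ρ (eta g) = f g := fun g => QuotientGroup.lift_mk K.toSubgroup hK g
  -- they agree after composing with the twist, on `η a` and `η b`
  have key : πH.comp ((twist φ : F₂hatT ≃ₜ* F₂hatT) : F₂hatT →ₜ* F₂hatT) = ρ := by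
    refine ext_of_eta ?_ ?_
    · change πH (twist φ (eta (FreeGroup.of 0))) = ρ (eta (FreeGroup.of 0))
      rw [twist_eta_of_zero, hπη, hρη, hfa]
    · change πH (twist φ (eta (FreeGroup.of 1))) = ρ (eta (FreeGroup.of 1))
      rw [twist_eta_of_one, hρη, hfb,
        apply_bPow_eq_pow πH ⟨Monoid.exponent (F₂ ⧸ H.toSubgroup), exponent_quotient_pos H⟩
          (fun q => Monoid.pow_exponent_eq_one q), iotaZ_one_eq, ← ZHatLevel.levelChar_apply, hc₀, hπη]
      rfl
  exact DFunLike.congr_fun key x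

/-- **Joint continuity of the twist** `(σ, x) ↦ θ_{c(σ)} x` on `G × F̂₂`, for any `c : G → Aut(Ẑ)` whose level
characters `χ_N ∘ c` are all locally constant (e.g. the cyclotomic character of `G_{ℚ_p}` in the Krull topology).
Each finite component of `θ_{c(σ)} x` is locally constant in `(σ, x)` by `val_twist_eq`. [cite: MochizukiEtTh2009, §1 p.12] -/
theorem continuous_twist_of_isLocallyConstant {G : Type*} [TopologicalSpace G] (c : G → MulAut ZH)
    (hc : ∀ N : ℕ+, IsLocallyConstant fun σ => ZHatLevel.levelChar N (c σ)) :
    Continuous fun q : G × F₂hatT => twist (c q.1) q.2 := by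
  refine continuous_induced_rng.2 (continuous_pi fun H => ?_)
  haveI : DiscreteTopology ((diagram (GrpCat.of F₂)).obj H) := ⟨rfl⟩
  refine (IsLocallyConstant.iff_exists_open _).2 (fun q₀ => ?_) |>.continuous
  -- the data at `q₀`: exponent `e`, character value `c₀`, the twisted quotient map `f` and its kernel `K`
  let e : ℕ+ := ⟨Monoid.exponent (F₂ ⧸ H.toSubgroup), exponent_quotient_pos H⟩
  let c₀ : ZMod e := ZHatLevel.levelChar e (c q₀.1)
  let f : F₂ →* F₂ ⧸ H.toSubgroup :=
    FreeGroup.lift ![QuotientGroup.mk (FreeGroup.of 0), QuotientGroup.mk (FreeGroup.of 1) ^ c₀.val]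
  have hfa : f (FreeGroup.of 0) = QuotientGroup.mk (FreeGroup.of 0) := by
    change FreeGroup.lift _ (FreeGroup.of 0) = _; rw [FreeGroup.lift_apply_of]; rfl
  have hfb : f (FreeGroup.of 1) = QuotientGroup.mk (FreeGroup.of 1) ^ c₀.val := by
    change FreeGroup.lift _ (FreeGroup.of 1) = _; rw [FreeGroup.lift_apply_of]; rfl
  haveI : Finite (F₂ ⧸ H.toSubgroup) := Subgroup.finite_quotient_of_finiteIndex
  haveI hKfi : f.ker.FiniteIndex := Subgroup.finiteIndex_ker f
  let K : FiniteIndexNormalSubgroup F₂ := { toSubgroup := f.ker, isFiniteIndex' := hKfi }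
  haveI : DiscreteTopology ((diagram (GrpCat.of F₂)).obj K) := ⟨rfl⟩
  have hcK : Continuous fun x : F₂hatT => x.val K := (continuous_apply K).comp continuous_subtype_val
  -- the open neighbourhood `{χ_e(c σ) = c₀} × {x ≡ x₀ mod K}`
  refine ⟨{σ | ZHatLevel.levelChar e (c σ) = c₀} ×ˢ ((fun x : F₂hatT => x.val K) ⁻¹' {q₀.2.val K}),
    ((hc e).isOpen_fiber c₀).prod ((isOpen_discrete _).preimage hcK), ⟨rfl, rfl⟩, ?_⟩
  rintro ⟨σ, x⟩ ⟨hσ, hx⟩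
  change (twist (c σ) x).val H = (twist (c q₀.1) q₀.2).val H
  rw [val_twist_eq H (c σ) x c₀ hσ f hfa hfb K le_rfl, val_twist_eq H (c q₀.1) q₀.2 c₀ rfl f hfa hfb K le_rfl]
  exact congrArg (QuotientGroup.lift K.toSubgroup f le_rfl) hx

/-- **Joint continuity of the twist on `Γ = F̂₂ ×_Ẑ ℤ`**: `(σ, γ) ↦ twistGfp (c σ) γ` is continuous under the
same local-constancy hypothesis — the input making `Γ ⋊_{twistGfp ∘ c} G` a topological group.
[cite: MochizukiEtTh2009, §1 p.12] -/
theorem continuous_twistGfp_of_isLocallyConstant {G : Type*} [TopologicalSpace G] (c : G → MulAut ZH)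
    (hc : ∀ N : ℕ+, IsLocallyConstant fun σ => ZHatLevel.levelChar N (c σ)) :
    Continuous fun q : G × Gfp => twistGfp (c q.1) q.2 := by
  refine continuous_induced_rng.2 ?_
  have hfun : (fun q : G × Gfp => ((twistGfp (c q.1) q.2 : Gfp) : F₂hatT × Multiplicative ℤ)) =
      fun q => (twist (c q.1) (q.2 : F₂hatT × Multiplicative ℤ).1, (q.2 : F₂hatT × Multiplicative ℤ).2) :=
    funext fun q => coe_twistGfp (c q.1) q.2
  change Continuous (fun q : G × Gfp => ((twistGfp (c q.1) q.2 : Gfp) : F₂hatT × Multiplicative ℤ))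
  rw [hfun]
  refine Continuous.prodMk ?_ (continuous_snd.comp (continuous_subtype_val.comp continuous_snd))
  have h2 : Continuous fun q : G × Gfp => (q.1, (q.2 : F₂hatT × Multiplicative ℤ).1) :=
    continuous_fst.prodMk (continuous_fst.comp (continuous_subtype_val.comp continuous_snd))
  exact Continuous.comp (f := fun q : G × Gfp => (q.1, (q.2 : F₂hatT × Multiplicative ℤ).1))
    (g := fun q : G × F₂hatT => twist (c q.1) q.2) (continuous_twist_of_isLocallyConstant c hc) h2

end Literature.AnabelianGeometry.EtaleTheta.SettingModel

end
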